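import Literature.NumberTheory.DiophantineApproximation.DilogHermitePadePartialFractions
import Literature.NumberTheory.DiophantineApproximation.DilogHermitePadeSeries
import Literature.NumberTheory.DiophantineApproximation.DilogHermitePadeBounds
import Literature.NumberTheory.DiophantineApproximation.DilogHermitePadeArithmetic
import Literature.NumberTheory.DiophantineApproximation.IrrationalFormsTransference
import Literature.NumberTheory.DiophantineApproximation.FactorialRatioRate
import Literature.NumberTheory.Transcendental.ZetaLinearFormsCriterion
import Literature.Barriers.KontsevichZagierPeriods.GrothendieckPeriodConjectureDependenceProofs
import Mathlib.Analysis.SpecialFunctions.Pow.Asymptotics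
import Mathlib.Analysis.Complex.ExponentialBounds
import Mathlib.Analysis.SpecialFunctions.Log.Deriv
import HarnessLib

/-!
# Linear independence of `1, Li₁(1/N), Li₂(1/N)` over `ℚ` for `N ≥ 10¹⁰`

Topic `Literature/NumberTheory/DiophantineApproximation`. We prove, for every integer
`N ≥ 10¹⁰`, that the three real numbers

  `1`,  `L₁ = ∑_{k≥1} N^{-k}/k = −log(1 − 1/N) = log(N/(N−1))`,  `L₂ = ∑_{k≥1} N^{-k}/k² = Li₂(1/N)`

are linearly independent over `ℚ` (`DilogPade.intRelation_trivial`,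
`one_polylogOne_polylogTwo_linearIndependent`). This is a (weak, large-`N`) special case of the
classical theorem of Nikišin (1979) and Hata (1990) on polylogarithms at `1/N`, in the form of
David–Hirata-Kohno–Kawashima 2020, Thm 2.1 (every weight, explicit `N₀(w)`); Viola–Zudilin 2018
reach much smaller thresholds; we make no attempt at a good one.
-- TODO(general form): all weights `w` and the thresholds of [DavidHirataKohnoKawashima2020, Thm 2.1].

## Proof (assembled from the sibling files)

The type-I Hermite–Padé forms `S_n = ∑_{t≥1} R_n(t) N^{-t}`, `R_n(t) = ∏_{j≤2n}(t−j)/∏_{i≤n}(t+i)²`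
(`DilogHermitePade.lean`) satisfy `S_n = a_n L₂ + b_n L₁ + c_n` (partial fractions
`DilogHermitePadePartialFractions.lean` + `DilogHermitePadeSeries.lean`) with `a_n ∈ ℤ`,
`D_n b_n, D_n c_n ∈ ℤ` for `D_n = lcm(1..3n) lcm(1..n)²` and `|a_n|, |b_n|, |c_n| ≤ 10 n³ 2^{7n} N^n`
(`DilogHermitePadeArithmetic.lean`), and `(2n)!³/((3n+1)!)² N^{−2n−1} ≤ S_n ≤ N^{−2n}`
(`DilogHermitePadeBounds.lean`). With `D_n ≤ e^{(5+ε)n}` (prime number theorem, tree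
`eventually_lcmUpto_mul_le_exp`) and `(2n)!³/((3n+1)!)² ≥ e^{−(6 log(3/2)+ε)n}`
(`FactorialRatioRate.lean`) the integer forms `ℓ_n = D_n S_n = r_n L₂ + q_n L₁ + p_n` have
`e^{−(2 log N + κ + ε)n} ≤ ℓ_n ≤ e^{−(2 log N − 5 − ε)n}` and coefficients `≤ e^{(log N + 7 log 2 + 5 + ε)n}`
(`κ = 6 log(3/2)`). Given a relation `a + b L₁ + c L₂ = 0`, if `c = 0` then `a = b = 0` because
`L₁ = log(N/(N−1))` is irrational (Hermite–Lindemann, tree `irrational_log_ratCast`); if `c ≠ 0`,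
the integer forms `(c p_n − a r_n) + (c q_n − b r_n) L₁ = c ℓ_n` in the single irrational `L₁` are
too good: the two-rate transference lemma `no_integer_forms_of_irrational`
(`IrrationalFormsTransference.lean`, the case `m = 1` of Nesterenko's criterion) needs
`A₁ + B < 2 A₂`, i.e. `log N > 6 log(3/2) + 7 log 2 + 15 + O(ε) ≈ 22.3`, and `log 10¹⁰ ≈ 23.0`.

References: E. M. Nikišin, Mat. Sb. 109 (1979); M. Hata, J. Math. Pures Appl. 69 (1990);
C. Viola, W. Zudilin, J. reine angew. Math. 736 (2018); S. David, N. Hirata-Kohno, M. Kawashima,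
Moscow J. Comb. Number Th. 9 (2020), Thm 2.1.
-/

noncomputable section

open Finset Filter Real

namespace Literature.NumberTheory.DiophantineApproximation

namespace DilogPade

open _root_.Filter _root_.Topology

/-! ## Elementary eventual inequalities -/

/-- A constant is eventually below `exp(δ n)` (`δ > 0`). [folklore] -/
theorem eventually_const_le_exp_mul (C : ℝ) {δ : ℝ} (hδ : 0 < δ) :
    ∀ᶠ n : ℕ in atTop, C ≤ Real.exp (δ * n) := by
  have h : Tendsto (fun n : ℕ => Real.exp (δ * n)) atTop atTop :=
    tendsto_exp_atTop.comp (tendsto_natCast_atTop_atTop.const_mul_atTop hδ)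
  exact h.eventually_ge_atTop C

/-- A constant is eventually below `δ n` (`δ > 0`). [folklore] -/
theorem eventually_const_le_mul (C : ℝ) {δ : ℝ} (hδ : 0 < δ) :
    ∀ᶠ n : ℕ in atTop, C ≤ δ * n :=
  (tendsto_natCast_atTop_atTop.const_mul_atTop hδ).eventually_ge_atTop C

/-- `C n^k ≤ exp(δ n)` eventually (`δ > 0`). [folklore] -/
theorem eventually_const_mul_pow_le_exp_mul (C : ℝ) (k : ℕ) {δ : ℝ} (hδ : 0 < δ) :
    ∀ᶠ n : ℕ in atTop, C * (n : ℝ) ^ k ≤ Real.exp (δ * n) := by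
  have hlo := isLittleO_pow_exp_pos_mul_atTop k hδ
  have hc : (0 : ℝ) < 1 / (|C| + 1) := by positivity
  have h := (hlo.def hc).and (eventually_ge_atTop (0 : ℝ))
  have h' := tendsto_natCast_atTop_atTop.eventually h
  filter_upwards [h'] with n ⟨hn, hn0⟩
  rw [Real.norm_eq_abs, Real.norm_eq_abs, abs_of_nonneg (pow_nonneg hn0 k),
    abs_of_nonneg (Real.exp_pos _).le] at hn
  have hC : C ≤ |C| := le_abs_self C
  have hE : 0 ≤ Real.exp (δ * n) := (Real.exp_pos _).le
  calc C * (n : ℝ) ^ k ≤ |C| * (1 / (|C| + 1) * Real.exp (δ * n)) :=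
        (mul_le_mul_of_nonneg_right hC (pow_nonneg hn0 k)).trans
          (mul_le_mul_of_nonneg_left hn (abs_nonneg C))
    _ = (|C| / (|C| + 1)) * Real.exp (δ * n) := by ring
    _ ≤ 1 * Real.exp (δ * n) := by
        refine mul_le_mul_of_nonneg_right ?_ hE
        rw [div_le_one (by positivity)]; linarith [abs_nonneg C]
    _ = Real.exp (δ * n) := one_mul _

/-- Growth of the common denominator: `D_n = lcm(1..3n)·lcm(1..n)² ≤ e^{(5+δ)n}` eventually
(prime number theorem, through the tree's `eventually_lcmUpto_mul_le_exp`). [folklore] -/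
theorem eventually_denom_le_exp {δ : ℝ} (hδ : 0 < δ) :
    ∀ᶠ n : ℕ in atTop, (denom n : ℝ) ≤ Real.exp ((5 + δ) * n) := by
  have hδ2 : 0 < δ / 2 := by positivity
  have h3 := Literature.NumberTheory.Transcendental.eventually_lcmUpto_mul_le_exp 3 hδ2
  have h1 := Literature.NumberTheory.Transcendental.eventually_lcmUpto_mul_pow_le_exp 1 2 hδ2
  filter_upwards [h3, h1] with n hn3 hn1
  rw [one_mul] at hn1
  push_cast at hn3 hn1
  rw [denom, Nat.cast_mul, Nat.cast_pow]
  calc ((3 * n).lcmUpto : ℝ) * (n.lcmUpto : ℝ) ^ 2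
      ≤ Real.exp ((3 + δ / 2) * n) * Real.exp ((1 * 2 + δ / 2) * n) :=
        mul_le_mul (by exact_mod_cast hn3) hn1 (by positivity) (Real.exp_pos _).le
    _ = Real.exp ((5 + δ) * n) := by rw [← Real.exp_add]; ring_nf

/-! ## Powers as exponentials -/

/-- `y^m = exp(m log y)` for `y > 0`. [folklore] -/
theorem pow_eq_exp_log_mul {y : ℝ} (hy : 0 < y) (m : ℕ) : y ^ m = Real.exp (Real.log y * m) := by
  rw [mul_comm, Real.exp_nat_mul, Real.exp_log hy]

/-- `(1/y)^m = exp(−m log y)` for `y > 0`. [folklore] -/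
theorem one_div_pow_eq_exp {y : ℝ} (hy : 0 < y) (m : ℕ) :
    (1 / y) ^ m = Real.exp (-(Real.log y * m)) := by
  rw [one_div_pow, pow_eq_exp_log_mul hy, Real.exp_neg, one_div]

/-! ## The weight-one value and its irrationality -/

/-- `L₁(1/N) = ∑_{k≥1} N^{-k}/k = log(N/(N−1))` for `N ≥ 2` (the logarithmic series). [folklore] -/
theorem polylogSeries_one_eq_log {N : ℕ} (hN : 2 ≤ N) :
    polylogSeries 1 (1 / (N : ℝ)) = Real.log ((N : ℝ) / ((N : ℝ) - 1)) := by
  have hN' : (2 : ℝ) ≤ N := by exact_mod_cast hN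
  have hx : |1 / (N : ℝ)| < 1 := by
    rw [abs_of_nonneg (by positivity), div_lt_one (by linarith)]; linarith
  have h := (Real.hasSum_pow_div_log_of_abs_lt_one hx).tsum_eq
  rw [polylogSeries]
  simp only [pow_one]
  rw [h, ← Real.log_inv]
  congr 1
  rw [one_sub_div (by linarith), inv_div]

/-- `L₁(1/N) = log(N/(N−1))` is irrational for `N ≥ 2` (Hermite–Lindemann, through the tree's
`irrational_log_ratCast`). [folklore] -/
theorem irrational_polylogSeries_one {N : ℕ} (hN : 2 ≤ N) :
    Irrational (polylogSeries 1 (1 / (N : ℝ))) := by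
  rw [polylogSeries_one_eq_log hN]
  have hN' : (2 : ℚ) ≤ N := by exact_mod_cast hN
  have hq : (0 : ℚ) < (N : ℚ) / ((N : ℚ) - 1) := div_pos (by linarith) (by linarith)
  have hq1 : (N : ℚ) / ((N : ℚ) - 1) ≠ 1 := by
    rw [Ne, div_eq_one_iff_eq (by linarith)]; linarith
  have h := Literature.Barriers.KontsevichZagierPeriods.irrational_log_ratCast _ hq hq1
  have hcast : (((N : ℚ) / ((N : ℚ) - 1) : ℚ) : ℝ) = (N : ℝ) / ((N : ℝ) - 1) := by push_cast; ring
  rwa [hcast] at h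

/-! ## The main theorem -/

/-- **No integer relation** `a + b L₁ + c L₂ = 0` among `1, L₁ = Li₁(1/N), L₂ = Li₂(1/N)` for
`N ≥ 10¹⁰` except the trivial one (type-I Hermite–Padé forms + prime number theorem + Stirling +
the `m = 1` transference lemma; weight one by the irrationality of `log(N/(N−1))`).
[cite: DavidHirataKohnoKawashima2020, Thm 2.1] -/
theorem intRelation_trivial (N : ℕ) (hN : 10 ^ 10 ≤ N) (a b c : ℤ)
    (h : (a : ℝ) + b * polylogSeries 1 (1 / (N : ℝ)) + c * polylogSeries 2 (1 / (N : ℝ)) = 0) :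
    a = 0 ∧ b = 0 ∧ c = 0 := by
  have hN2 : 2 ≤ N := le_trans (by norm_num) hN
  have hN1 : 1 ≤ N := le_trans (by norm_num) hN2
  have hNr : (2 : ℝ) ≤ N := by exact_mod_cast hN2
  have hNpos : (0 : ℝ) < N := by linarith
  have hx0 : (0 : ℝ) < 1 / N := by positivity
  have hx1 : 1 / (N : ℝ) ≤ 1 / 2 := one_div_le_one_div_of_le (by norm_num) hNr
  have hx1' : 1 / (N : ℝ) < 1 := by linarith
  have hirr := irrational_polylogSeries_one hN2
  set L₁ := polylogSeries 1 (1 / (N : ℝ)) with hL₁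
  set L₂ := polylogSeries 2 (1 / (N : ℝ)) with hL₂
  by_cases hc : c = 0
  · -- weight one: `a + b L₁ = 0` forces `b = 0` (irrationality of `L₁`) and then `a = 0`
    subst hc
    have h' : (a : ℝ) + b * L₁ = 0 := by simpa using h
    by_cases hb : b = 0
    · subst hb
      have ha : (a : ℝ) = 0 := by simpa using h'
      exact ⟨by exact_mod_cast ha, rfl, rfl⟩
    · exfalso
      have hb' : (b : ℝ) ≠ 0 := by exact_mod_cast hb
      refine hirr.ne_rat ((-a : ℚ) / b) ?_
      push_cast
      field_simp
      linarith
  · exfalso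
    -- the integer forms `ℓ_n = D_n S_n = r_n L₂ + q_n L₁ + p_n`
    choose q hq using fun n => isInt_denom_mul_formB n N
    choose p hp using fun n => isInt_denom_mul_formC n N
    set r : ℕ → ℤ := fun n => (denom n : ℤ) * formA n N with hr
    have hqR : ∀ n, (q n : ℝ) = (denom n : ℝ) * ((formB n N : ℚ) : ℝ) := fun n => by
      have h1 := congrArg (fun t : ℚ => (t : ℝ)) (hq n)
      push_cast at h1
      linarith
    have hpR : ∀ n, (p n : ℝ) = (denom n : ℝ) * ((formC n N : ℚ) : ℝ) := fun n => by
      have h1 := congrArg (fun t : ℚ => (t : ℝ)) (hp n)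
      push_cast at h1
      linarith
    have hrR : ∀ n, (r n : ℝ) = (denom n : ℝ) * (formA n N : ℝ) := fun n => by
      simp only [hr]; push_cast; ring
    have hval : ∀ n, (denom n : ℝ) * form n (1 / (N : ℝ)) = r n * L₂ + q n * L₁ + p n := by
      intro n
      rw [form_eq_of_partialFractions hN2 (kernel_succ_eq_partialFractions n), hrR, hqR, hpR]
      ring
    -- the forms in the single irrational `L₁`
    have hPQ : ∀ n, ((c * p n - a * r n : ℤ) : ℝ) + ((c * q n - b * r n : ℤ) : ℝ) * L₁ =
        c * ((denom n : ℝ) * form n (1 / (N : ℝ))) := by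
      intro n
      rw [hval n]
      push_cast
      linear_combination (-(r n : ℝ)) * h
    have hDform_pos : ∀ n, 0 < (denom n : ℝ) * form n (1 / (N : ℝ)) := fun n =>
      mul_pos (by exact_mod_cast denom_pos n) (form_pos n hx0 hx1')
    have hcabs : (1 : ℝ) ≤ |(c : ℝ)| := by exact_mod_cast Int.one_le_abs hc
    -- the constants (kept opaque, with their defining equations, for `linarith`)
    obtain ⟨l2, hl2def⟩ : ∃ l2 : ℝ, l2 = Real.log 2 := ⟨_, rfl⟩
    obtain ⟨L, hLdef⟩ : ∃ L : ℝ, L = Real.log N := ⟨_, rfl⟩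
    obtain ⟨κ, hκdef⟩ : ∃ κ : ℝ, κ = 6 * Real.log (3 / 2) := ⟨_, rfl⟩
    obtain ⟨δ, hδdef⟩ : ∃ δ : ℝ, δ = 1 / 40 := ⟨_, rfl⟩
    have hδ : (0 : ℝ) < δ := by rw [hδdef]; norm_num
    have hδ2 : (0 : ℝ) < 2 * δ := by linarith
    have hl2 : 0.6931471803 < l2 := by rw [hl2def]; exact Real.log_two_gt_d9
    have hκ0 : 0 ≤ κ := by
      rw [hκdef]; exact mul_nonneg (by norm_num) (Real.log_nonneg (by norm_num))
    have hκ : κ < 18 / 5 * l2 := by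
      have h1 : Real.log (((3 : ℝ) / 2) ^ 5) < Real.log ((2 : ℝ) ^ 3) :=
        Real.log_lt_log (by positivity) (by norm_num)
      rw [Real.log_pow, Real.log_pow] at h1
      push_cast at h1
      rw [hκdef, hl2def]
      linarith
    have hL : 33 * l2 ≤ L := by
      have h2 : ((2 : ℝ) ^ 33) ≤ N := by
        exact_mod_cast (le_trans (by norm_num : 2 ^ 33 ≤ 10 ^ 10) hN)
      have := Real.log_le_log (by positivity) h2
      rw [Real.log_pow] at this
      push_cast at this
      rw [hl2def, hLdef]
      exact this
    have hLpos : 0 < L := by linarith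
    -- powers as exponentials in the opaque constants
    have hxpow : ∀ m : ℕ, (1 / (N : ℝ)) ^ m = Real.exp (-(L * m)) := fun m => by
      rw [hLdef]; exact one_div_pow_eq_exp hNpos m
    have hNpow : ∀ m : ℕ, (N : ℝ) ^ m = Real.exp (L * m) := fun m => by
      rw [hLdef]; exact pow_eq_exp_log_mul hNpos m
    have h2pow : ∀ m : ℕ, (2 : ℝ) ^ m = Real.exp (l2 * m) := fun m => by
      rw [hl2def]; exact pow_eq_exp_log_mul two_pos m
    -- the transference lemma with `A₁ = 2L + κ + 2δ`, `A₂ = 2L − 5 − 3δ`, `B = L + 7 log 2 + 5 + 3δ`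
    refine no_integer_forms_of_irrational hirr (A₁ := 2 * L + κ + 2 * δ) (A₂ := 2 * L - 5 - 3 * δ)
      (B := L + 7 * l2 + 5 + 3 * δ) ?_ ?_ ?_ ?_
      (fun n => c * p n - a * r n) (fun n => c * q n - b * r n) ?_ ?_ ?_
    · -- `0 < A₂`
      linarith
    · -- `A₂ ≤ A₁`
      linarith
    · -- `0 ≤ B`
      linarith
    · -- the gap `A₁ + B < 2 A₂`, i.e. `κ + 7 log 2 + 15 + 11 δ < log N`
      linarith
    · -- lower bound `e^{-A₁ n} ≤ |c| ℓ_n`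
      have hfac' := eventually_exp_le_factorial_ratio hδ
      rw [← hκdef] at hfac'
      filter_upwards [hfac', eventually_const_le_mul L hδ] with n hfac hLn
      show Real.exp (-((2 * L + κ + 2 * δ) * n)) ≤
        |((c * p n - a * r n : ℤ) : ℝ) + ((c * q n - b * r n : ℤ) : ℝ) * L₁|
      rw [hPQ n, abs_mul, abs_of_pos (hDform_pos n)]
      calc Real.exp (-((2 * L + κ + 2 * δ) * n))
          ≤ Real.exp (-((κ + δ) * n)) * Real.exp (-(L * ((2 * n + 1 : ℕ) : ℝ))) := by
            rw [← Real.exp_add]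
            apply Real.exp_le_exp.2
            push_cast
            linear_combination hLn
        _ ≤ ((2 * n).factorial : ℝ) ^ 3 / (((3 * n + 1).factorial : ℝ) ^ 2) *
              (1 / (N : ℝ)) ^ (2 * n + 1) := by
            rw [hxpow]
            exact mul_le_mul_of_nonneg_right hfac (Real.exp_pos _).le
        _ ≤ form n (1 / (N : ℝ)) := form_ge n hx0.le hx1'
        _ ≤ |(c : ℝ)| * ((denom n : ℝ) * form n (1 / (N : ℝ))) := by
            rw [← mul_assoc]
            refine le_mul_of_one_le_left (form_pos n hx0 hx1').le ?_
            exact one_le_mul_of_one_le_of_one_le hcabs (by exact_mod_cast denom_pos n)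
    · -- upper bound `|c| ℓ_n ≤ e^{-A₂ n}`
      filter_upwards [eventually_denom_le_exp hδ2, eventually_const_le_exp_mul |(c : ℝ)| hδ,
        eventually_ge_atTop 1] with n hD hcδ hn1
      show |((c * p n - a * r n : ℤ) : ℝ) + ((c * q n - b * r n : ℤ) : ℝ) * L₁| ≤
        Real.exp (-((2 * L - 5 - 3 * δ) * n))
      rw [hPQ n, abs_mul, abs_of_pos (hDform_pos n)]
      have hform_le : form n (1 / (N : ℝ)) ≤ (1 / (N : ℝ)) ^ (2 * n) := form_le hn1 hx0.le hx1
      calc |(c : ℝ)| * ((denom n : ℝ) * form n (1 / (N : ℝ)))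
          ≤ Real.exp (δ * n) *
              (Real.exp ((5 + 2 * δ) * n) * Real.exp (-(L * ((2 * n : ℕ) : ℝ)))) := by
            refine mul_le_mul hcδ ?_ (hDform_pos n).le (Real.exp_pos _).le
            rw [← hxpow]
            exact mul_le_mul hD hform_le (form_pos n hx0 hx1').le (by positivity)
        _ = Real.exp (-((2 * L - 5 - 3 * δ) * n)) := by
            rw [← Real.exp_add, ← Real.exp_add]
            congr 1
            push_cast
            ring
    · -- growth of the coefficients `|c q_n − b r_n| ≤ e^{B n}`
      filter_upwards [eventually_denom_le_exp hδ2,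
        eventually_const_mul_pow_le_exp_mul ((|(b : ℝ)| + |(c : ℝ)|) * 10) 3 hδ,
        eventually_ge_atTop 1] with n hD hpoly hn1
      show |((c * q n - b * r n : ℤ) : ℝ)| ≤ Real.exp ((L + 7 * l2 + 5 + 3 * δ) * n)
      set M : ℝ := 10 * (n : ℝ) ^ 3 * 2 ^ (7 * n) * (N : ℝ) ^ n with hMdef
      have hD0 : (0 : ℝ) ≤ denom n := by positivity
      have hq_le : |(q n : ℝ)| ≤ (denom n : ℝ) * M := by
        rw [hqR, abs_mul, abs_of_nonneg hD0]
        exact mul_le_mul_of_nonneg_left (abs_formB_le hn1 hN1) hD0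
      have hr_le : |(r n : ℝ)| ≤ (denom n : ℝ) * M := by
        rw [hrR, abs_mul, abs_of_nonneg hD0]
        exact mul_le_mul_of_nonneg_left (abs_formA_le hn1 hN1) hD0
      calc |((c * q n - b * r n : ℤ) : ℝ)|
          = |(c : ℝ) * q n - b * r n| := by push_cast; ring_nf
        _ ≤ |(c : ℝ) * q n| + |(b : ℝ) * r n| := abs_sub _ _
        _ = |(c : ℝ)| * |(q n : ℝ)| + |(b : ℝ)| * |(r n : ℝ)| := by rw [abs_mul, abs_mul]
        _ ≤ |(c : ℝ)| * ((denom n : ℝ) * M) + |(b : ℝ)| * ((denom n : ℝ) * M) :=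
            add_le_add (mul_le_mul_of_nonneg_left hq_le (abs_nonneg _))
              (mul_le_mul_of_nonneg_left hr_le (abs_nonneg _))
        _ = ((|(b : ℝ)| + |(c : ℝ)|) * 10 * (n : ℝ) ^ 3) * (denom n : ℝ) *
              ((2 : ℝ) ^ (7 * n) * (N : ℝ) ^ n) := by
            simp only [hMdef]; ring
        _ ≤ Real.exp (δ * n) * Real.exp ((5 + 2 * δ) * n) *
              ((2 : ℝ) ^ (7 * n) * (N : ℝ) ^ n) := by
            refine mul_le_mul_of_nonneg_right ?_ (by positivity)
            exact mul_le_mul hpoly hD hD0 (Real.exp_pos _).le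
        _ = Real.exp ((L + 7 * l2 + 5 + 3 * δ) * n) := by
            rw [h2pow, hNpow, ← Real.exp_add, ← Real.exp_add, ← Real.exp_add]
            congr 1
            push_cast
            ring

end DilogPade

open DilogPade in
/-- **Linear independence of `1, Li₁(1/N), Li₂(1/N)` over `ℚ` for `N ≥ 10¹⁰`**: with
`L_s = ∑_{k≥1} N^{-k}/k^s` (`DilogPade.polylogSeries s (1/N)`; `L₁ = log(N/(N−1))`,
`L₂ = Li₂(1/N)`), every rational relation `a + b L₁ + c L₂ = 0` is trivial. A large-`N` special
case of Nikišin 1979 / Hata 1990 / David–Hirata-Kohno–Kawashima 2020, Thm 2.1.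
[cite: DavidHirataKohnoKawashima2020, Thm 2.1] -/
theorem one_polylogOne_polylogTwo_linearIndependent (N : ℕ) (hN : 10 ^ 10 ≤ N) (a b c : ℚ)
    (h : (a : ℝ) + b * DilogPade.polylogSeries 1 (1 / (N : ℝ)) +
      c * DilogPade.polylogSeries 2 (1 / (N : ℝ)) = 0) :
    a = 0 ∧ b = 0 ∧ c = 0 := by
  -- clear denominators with `d = a.den · b.den · c.den`
  set d : ℕ := a.den * b.den * c.den with hd
  have hd0 : d ≠ 0 := by simp [hd]
  have ha : (((a.num * b.den * c.den : ℤ) : ℚ) : ℝ) = (d : ℝ) * a := by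
    have h1 : ((a.num * b.den * c.den : ℤ) : ℚ) = (d : ℚ) * a := by
      simp only [hd]; push_cast; rw [← Rat.mul_den_eq_num a]; ring
    rw [h1]; push_cast; ring
  have hb : (((b.num * a.den * c.den : ℤ) : ℚ) : ℝ) = (d : ℝ) * b := by
    have h1 : ((b.num * a.den * c.den : ℤ) : ℚ) = (d : ℚ) * b := by
      simp only [hd]; push_cast; rw [← Rat.mul_den_eq_num b]; ring
    rw [h1]; push_cast; ring
  have hc : (((c.num * a.den * b.den : ℤ) : ℚ) : ℝ) = (d : ℝ) * c := by
    have h1 : ((c.num * a.den * b.den : ℤ) : ℚ) = (d : ℚ) * c := by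
      simp only [hd]; push_cast; rw [← Rat.mul_den_eq_num c]; ring
    rw [h1]; push_cast; ring
  have h' : ((a.num * b.den * c.den : ℤ) : ℝ) +
      (b.num * a.den * c.den : ℤ) * DilogPade.polylogSeries 1 (1 / (N : ℝ)) +
      (c.num * a.den * b.den : ℤ) * DilogPade.polylogSeries 2 (1 / (N : ℝ)) = 0 := by
    have ea : ((a.num * b.den * c.den : ℤ) : ℝ) = (d : ℝ) * a := by exact_mod_cast ha
    have eb : ((b.num * a.den * c.den : ℤ) : ℝ) = (d : ℝ) * b := by exact_mod_cast hb
    have ec : ((c.num * a.den * b.den : ℤ) : ℝ) = (d : ℝ) * c := by exact_mod_cast hc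
    rw [ea, eb, ec]
    linear_combination (d : ℝ) * h
  obtain ⟨h1, h2, h3⟩ := intRelation_trivial N hN _ _ _ h'
  have hbd : (b.den : ℤ) ≠ 0 := by exact_mod_cast b.den_nz
  have had : (a.den : ℤ) ≠ 0 := by exact_mod_cast a.den_nz
  have hcd : (c.den : ℤ) ≠ 0 := by exact_mod_cast c.den_nz
  refine ⟨?_, ?_, ?_⟩
  · have : a.num = 0 := by
      rcases mul_eq_zero.1 h1 with h | h
      · rcases mul_eq_zero.1 h with h | h
        · exact h
        · exact absurd h hbd
      · exact absurd h hcd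
    exact Rat.zero_of_num_zero this
  · have : b.num = 0 := by
      rcases mul_eq_zero.1 h2 with h | h
      · rcases mul_eq_zero.1 h with h | h
        · exact h
        · exact absurd h had
      · exact absurd h hcd
    exact Rat.zero_of_num_zero this
  · have : c.num = 0 := by
      rcases mul_eq_zero.1 h3 with h | h
      · rcases mul_eq_zero.1 h with h | h
        · exact h
        · exact absurd h had
      · exact absurd h hbd
    exact Rat.zero_of_num_zero this

end Literature.NumberTheory.DiophantineApproximation
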